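import Literature.Computability.AlgebraicComplexity.ValiantReductionCellsIII
import HarnessLib

/-!
# Valiant's reduction as a polynomial-time machine, IV: the bit of the `0/1` matrix (`b01`)

Fourth machine file. The `0/1` matrix `valiant01 ψ = flat (mz ψ) n q` (`n = 34m`, `q = 15m`,
`Valiant3CNFFlat.lean`) has the entrywise closed form `b01 (mz ψ) n q X Y`
(`PermanentZeroOneFlat.lean`: base part `baseOf`, tournament slots read off `(X - n) = s (q+2) + z`,
`s = u n + v`, activity `actOf q (mz u v)`). Here it becomes the one-bit brick `ValiantFP.bitF` on
`⟨⌜ψ⌝, ⟨1^X, 1^Y⟩⟩` (`bitF_encode : bitF … = [b01 (mz ψ) n q X Y = 1]` for `X, Y < n + n² (q+2)`),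
calling `mzF` (part III) at the three argument pairs `(X, Y)`, `(u_Y, v_Y)`, `(u_X, v_X)`; the
activity is the unary brick `actB` (`1^{q+1}`, `11`, or `ε` according to the class of the entry).

## References

* L. G. Valiant, *The complexity of computing the permanent*, Theoret. Comput. Sci. 8 (1979)
  189–201, Lemma 3.3, Thm. 1.
* C. H. Papadimitriou, *Computational Complexity*, Addison-Wesley 1994, Thm. 18.3 (proof).
* S. Arora, B. Barak, *Computational Complexity: A Modern Approach*, CUP 2009, §1.3.
-/

noncomputable section

namespace Literature.Computability.AlgebraicComplexity

open _root_.Computability Literature.Computability.Complexity Brick HashBricks Plumb OracleCompose Polynomial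
open Literature.LinearAlgebra.Matrix Valiant3CNF

namespace ValiantFP

variable (ψ : CNF ℕ)

/-! ### Division by a unary field -/

/-- Quotient of two unary fields: `quoV f g z = 1^{|f z| / |g z|}` (for unary `f z`, `g z`). [folklore] -/
def quoV (f g : List Bool → List Bool) : List Bool → List Bool := fstF ∘ divModFn ∘ fanoutFn g f

/-- Remainder of two unary fields: `remV f g z = 1^{|f z| mod |g z|}`. [folklore] -/
def remV (f g : List Bool → List Bool) : List Bool → List Bool := sndF ∘ divModFn ∘ fanoutFn g f

/-- Value of `quoV`. [folklore] -/
theorem quoV_apply (f g : List Bool → List Bool) (z : List Bool) (a b : ℕ) (hf : f z = ones a) (hg : g z = ones b) :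
    quoV f g z = ones (a / b) := by
  simp [quoV, hf, hg]

/-- Value of `remV`. [folklore] -/
theorem remV_apply (f g : List Bool → List Bool) (z : List Bool) (a b : ℕ) (hf : f z = ones a) (hg : g z = ones b) :
    remV f g z = ones (a % b) := by
  simp [remV, hf, hg]

/-- `quoV f g ∈ FP`. [folklore] -/
theorem quoV_mem_FP {f g : List Bool → List Bool} (hf : f ∈ FP) (hg : g ∈ FP) : quoV f g ∈ FP :=
  comp_mem_FP fstF_mem_FP (comp_mem_FP divModFn_mem_FP (fanoutFn_mem_FP hg hf))

/-- `remV f g ∈ FP`. [folklore] -/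
theorem remV_mem_FP {f g : List Bool → List Bool} (hf : f ∈ FP) (hg : g ∈ FP) : remV f g ∈ FP :=
  comp_mem_FP sndF_mem_FP (comp_mem_FP divModFn_mem_FP (fanoutFn_mem_FP hg hf))

/-! ### Fields of `⟨x₀, ⟨1^X, 1^Y⟩⟩` for the `0/1` matrix -/

/-- `1ⁿ`, `n = 34m`. [folklore] -/
def kN : List Bool → List Bool := mulB 34 gM
/-- `1^{q+2}`, `q = 15m` (nodes per slot). [folklore] -/
def kK : List Bool → List Bool := addB (mulB 15 gM) (cst (ones 2))
/-- `1^{q+1}` (activity of a `-1` entry). [folklore] -/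
def kQ1 : List Bool → List Bool := addB (mulB 15 gM) (cst (ones 1))
/-- `1^{X-n}`. [folklore] -/
def kXN : List Bool → List Bool := subB fR kN
/-- `1^{Y-n}`. [folklore] -/
def kYN : List Bool → List Bool := subB fS kN
/-- slot of `X`: `1^{(X-n)/(q+2)}`. [folklore] -/
def kSX : List Bool → List Bool := quoV kXN kK
/-- node of `X`: `1^{(X-n) mod (q+2)}`. [folklore] -/
def kZX : List Bool → List Bool := remV kXN kK
/-- slot of `Y`. [folklore] -/
def kSY : List Bool → List Bool := quoV kYN kK
/-- node of `Y`. [folklore] -/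
def kZY : List Bool → List Bool := remV kYN kK
/-- row of the slot of `X`: `1^{s_X / n}`. [folklore] -/
def kUX : List Bool → List Bool := quoV kSX kN
/-- column of the slot of `X`: `1^{s_X mod n}`. [folklore] -/
def kVX : List Bool → List Bool := remV kSX kN
/-- row of the slot of `Y`. [folklore] -/
def kUY : List Bool → List Bool := quoV kSY kN
/-- column of the slot of `Y`. [folklore] -/
def kVY : List Bool → List Bool := remV kSY kN

/-- The class of the entry `mz (u_X) (v_X)` (the entry carrying the slot of row `X`). [folklore] -/
def mzUX : List Bool → List Bool := mzF ∘ fanoutFn fstF (fanoutFn kUX kVX)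
/-- The class of the entry `mz (u_Y) (v_Y)`. [folklore] -/
def mzUY : List Bool → List Bool := mzF ∘ fanoutFn fstF (fanoutFn kUY kVY)

/-- **The activity `1^{actOf q v}` of an entry of class `c z`**: `ε ↦ 1^{q+1}`, `111, 1111 ↦ 11`, else `ε`. [cite: Papadimitriou1994, Thm. 18.3 (proof)] -/
def actB (c : List Bool → List Bool) : List Bool → List Bool :=
  iteB (eqB c (cst [])) kQ1 (iteB (orB (eqB c (cst (ones 3))) (eqB c (cst (ones 4)))) (cst (ones 2)) (cst []))

/-- `[baseOf v = 1]` for an entry of class `c z`: classes `11` and `1111`. [cite: Valiant1979, Lemma 3.3] -/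
def baseB (c : List Bool → List Bool) : List Bool → List Bool := orB (eqB c (cst (ones 2))) (eqB c (cst (ones 4)))

/-- **The bit `[b01 (mz ψ) n q X Y = 1]` of Valiant's `0/1` matrix** on `⟨⌜ψ⌝, ⟨1^X, 1^Y⟩⟩`. [cite: Valiant1979, Lemma 3.3] -/
def bitF : List Bool → List Bool :=
  iteB (ltB fR kN)
    (iteB (ltB fS kN) (baseB mzF)
      (andB (eqB fR kUY) (andB (eqB kZY (cst [])) (ltB (cst []) (actB mzUY)))))
    (iteB (ltB fS kN)
      (andB (eqB fS kVX) (ltB kZX (actB mzUX)))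
      (andB (eqB kSX kSY) (orB (eqB kZX kZY) (andB (ltB kZX kZY) (ltB kZY (actB mzUX))))))

/-! ### `FP` membership -/

/-- `kN ∈ FP`. [folklore] -/
theorem kN_mem_FP : kN ∈ FP := mulB_mem_FP 34 gM_mem_FP
/-- `kK ∈ FP`. [folklore] -/
theorem kK_mem_FP : kK ∈ FP := addB_mem_FP (mulB_mem_FP 15 gM_mem_FP) (cst_mem_FP _)
/-- `kQ1 ∈ FP`. [folklore] -/
theorem kQ1_mem_FP : kQ1 ∈ FP := addB_mem_FP (mulB_mem_FP 15 gM_mem_FP) (cst_mem_FP _)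
/-- `kXN ∈ FP`. [folklore] -/
theorem kXN_mem_FP : kXN ∈ FP := subB_mem_FP fR_mem_FP kN_mem_FP
/-- `kYN ∈ FP`. [folklore] -/
theorem kYN_mem_FP : kYN ∈ FP := subB_mem_FP fS_mem_FP kN_mem_FP
/-- `kSX ∈ FP`. [folklore] -/
theorem kSX_mem_FP : kSX ∈ FP := quoV_mem_FP kXN_mem_FP kK_mem_FP
/-- `kZX ∈ FP`. [folklore] -/
theorem kZX_mem_FP : kZX ∈ FP := remV_mem_FP kXN_mem_FP kK_mem_FP
/-- `kSY ∈ FP`. [folklore] -/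
theorem kSY_mem_FP : kSY ∈ FP := quoV_mem_FP kYN_mem_FP kK_mem_FP
/-- `kZY ∈ FP`. [folklore] -/
theorem kZY_mem_FP : kZY ∈ FP := remV_mem_FP kYN_mem_FP kK_mem_FP
/-- `kUX ∈ FP`. [folklore] -/
theorem kUX_mem_FP : kUX ∈ FP := quoV_mem_FP kSX_mem_FP kN_mem_FP
/-- `kVX ∈ FP`. [folklore] -/
theorem kVX_mem_FP : kVX ∈ FP := remV_mem_FP kSX_mem_FP kN_mem_FP
/-- `kUY ∈ FP`. [folklore] -/
theorem kUY_mem_FP : kUY ∈ FP := quoV_mem_FP kSY_mem_FP kN_mem_FP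
/-- `kVY ∈ FP`. [folklore] -/
theorem kVY_mem_FP : kVY ∈ FP := remV_mem_FP kSY_mem_FP kN_mem_FP
/-- `mzUX ∈ FP`. [folklore] -/
theorem mzUX_mem_FP : mzUX ∈ FP := comp_mem_FP mzF_mem_FP (fanoutFn_mem_FP fstF_mem_FP (fanoutFn_mem_FP kUX_mem_FP kVX_mem_FP))
/-- `mzUY ∈ FP`. [folklore] -/
theorem mzUY_mem_FP : mzUY ∈ FP := comp_mem_FP mzF_mem_FP (fanoutFn_mem_FP fstF_mem_FP (fanoutFn_mem_FP kUY_mem_FP kVY_mem_FP))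

/-- `actB c ∈ FP`. [folklore] -/
theorem actB_mem_FP {c : List Bool → List Bool} (hc : c ∈ FP) : actB c ∈ FP :=
  iteB_mem_FP (eqB_mem_FP hc (cst_mem_FP _)) kQ1_mem_FP
    (iteB_mem_FP (orB_mem_FP (eqB_mem_FP hc (cst_mem_FP _)) (eqB_mem_FP hc (cst_mem_FP _))) (cst_mem_FP _) (cst_mem_FP _))

/-- `baseB c ∈ FP`. [folklore] -/
theorem baseB_mem_FP {c : List Bool → List Bool} (hc : c ∈ FP) : baseB c ∈ FP :=
  orB_mem_FP (eqB_mem_FP hc (cst_mem_FP _)) (eqB_mem_FP hc (cst_mem_FP _))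

/-- **`bitF ∈ FP`.** [cite: Valiant1979, Thm. 1] -/
theorem bitF_mem_FP : bitF ∈ FP :=
  iteB_mem_FP (ltB_mem_FP fR_mem_FP kN_mem_FP)
    (iteB_mem_FP (ltB_mem_FP fS_mem_FP kN_mem_FP) (baseB_mem_FP mzF_mem_FP)
      (andB_mem_FP (eqB_mem_FP fR_mem_FP kUY_mem_FP) (andB_mem_FP (eqB_mem_FP kZY_mem_FP (cst_mem_FP _))
        (ltB_mem_FP (cst_mem_FP _) (actB_mem_FP mzUY_mem_FP)))))
    (iteB_mem_FP (ltB_mem_FP fS_mem_FP kN_mem_FP)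
      (andB_mem_FP (eqB_mem_FP fS_mem_FP kVX_mem_FP) (ltB_mem_FP kZX_mem_FP (actB_mem_FP mzUX_mem_FP)))
      (andB_mem_FP (eqB_mem_FP kSX_mem_FP kSY_mem_FP) (orB_mem_FP (eqB_mem_FP kZX_mem_FP kZY_mem_FP)
        (andB_mem_FP (ltB_mem_FP kZX_mem_FP kZY_mem_FP) (ltB_mem_FP kZY_mem_FP (actB_mem_FP mzUX_mem_FP))))))

/-- `bitF` answers one bit on every input. [folklore] -/
theorem length_bitF (z : List Bool) : (bitF z).length = 1 := by
  simp only [bitF, iteB_apply, andB_apply, baseB, orB_apply]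
  split_ifs <;> rfl

/-! ### Values of the fields -/

section Values

variable (x₀ : List Bool) (X Y : ℕ)

local notation "vv" => boolPair x₀ (boolPair (ones X) (ones Y))
set_option quotPrecheck false in
local notation "mm" => (fstF x₀).length

/-- Value of `kN`. [folklore] -/
theorem kN_val : kN vv = ones (34 * mm) := by rw [kN, mulB_apply, gM_val]
/-- Value of `kK`. [folklore] -/
theorem kK_val : kK vv = ones (15 * mm + 2) := by rw [kK, addB_apply, mulB_apply, gM_val, cst_apply, ones_append]
/-- Value of `kQ1`. [folklore] -/
theorem kQ1_val : kQ1 vv = ones (15 * mm + 1) := by rw [kQ1, addB_apply, mulB_apply, gM_val, cst_apply, ones_append]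
/-- Value of `kXN`. [folklore] -/
theorem kXN_val : kXN vv = ones (X - 34 * mm) := by rw [kXN, subB_apply, fR_val, kN_val, length_ones, ones_drop]
/-- Value of `kYN`. [folklore] -/
theorem kYN_val : kYN vv = ones (Y - 34 * mm) := by rw [kYN, subB_apply, fS_val, kN_val, length_ones, ones_drop]
/-- Value of `kSX`. [folklore] -/
theorem kSX_val : kSX vv = ones ((X - 34 * mm) / (15 * mm + 2)) := quoV_apply _ _ _ _ _ (kXN_val x₀ X Y) (kK_val x₀ X Y)
/-- Value of `kZX`. [folklore] -/
theorem kZX_val : kZX vv = ones ((X - 34 * mm) % (15 * mm + 2)) := remV_apply _ _ _ _ _ (kXN_val x₀ X Y) (kK_val x₀ X Y)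
/-- Value of `kSY`. [folklore] -/
theorem kSY_val : kSY vv = ones ((Y - 34 * mm) / (15 * mm + 2)) := quoV_apply _ _ _ _ _ (kYN_val x₀ X Y) (kK_val x₀ X Y)
/-- Value of `kZY`. [folklore] -/
theorem kZY_val : kZY vv = ones ((Y - 34 * mm) % (15 * mm + 2)) := remV_apply _ _ _ _ _ (kYN_val x₀ X Y) (kK_val x₀ X Y)
/-- Value of `kUX`. [folklore] -/
theorem kUX_val : kUX vv = ones ((X - 34 * mm) / (15 * mm + 2) / (34 * mm)) :=
  quoV_apply _ _ _ _ _ (kSX_val x₀ X Y) (kN_val x₀ X Y)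
/-- Value of `kVX`. [folklore] -/
theorem kVX_val : kVX vv = ones ((X - 34 * mm) / (15 * mm + 2) % (34 * mm)) :=
  remV_apply _ _ _ _ _ (kSX_val x₀ X Y) (kN_val x₀ X Y)
/-- Value of `kUY`. [folklore] -/
theorem kUY_val : kUY vv = ones ((Y - 34 * mm) / (15 * mm + 2) / (34 * mm)) :=
  quoV_apply _ _ _ _ _ (kSY_val x₀ X Y) (kN_val x₀ X Y)
/-- Value of `kVY`. [folklore] -/
theorem kVY_val : kVY vv = ones ((Y - 34 * mm) / (15 * mm + 2) % (34 * mm)) :=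
  remV_apply _ _ _ _ _ (kSY_val x₀ X Y) (kN_val x₀ X Y)
/-- The argument record passed on by `mzUX`. [folklore] -/
theorem mzUX_arg : mzUX vv = mzF (boolPair x₀ (boolPair (ones ((X - 34 * mm) / (15 * mm + 2) / (34 * mm)))
    (ones ((X - 34 * mm) / (15 * mm + 2) % (34 * mm))))) := by
  rw [mzUX, Function.comp_apply, fanoutFn_apply, fanoutFn_apply, fstF_boolPair, kUX_val, kVX_val]
/-- The argument record passed on by `mzUY`. [folklore] -/
theorem mzUY_arg : mzUY vv = mzF (boolPair x₀ (boolPair (ones ((Y - 34 * mm) / (15 * mm + 2) / (34 * mm)))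
    (ones ((Y - 34 * mm) / (15 * mm + 2) % (34 * mm))))) := by
  rw [mzUY, Function.comp_apply, fanoutFn_apply, fanoutFn_apply, fstF_boolPair, kUY_val, kVY_val]

/-- Value of `actB` on a class. [cite: Papadimitriou1994, Thm. 18.3 (proof)] -/
theorem actB_apply (c : List Bool → List Bool) (v : ℤ) (hv : v = -1 ∨ v = 0 ∨ v = 1 ∨ v = 2 ∨ v = 3) (hc : c vv = cls v) :
    actB c vv = ones (actOf (15 * mm) v) := by
  simp only [actB, iteB_apply, eqB_apply, orB_apply, hc, cst_apply, kQ1_val, List.headD_cons, actOf]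
  rcases hv with rfl | rfl | rfl | rfl | rfl <;> simp <;> decide

/-- Value of `baseB` on a class. [cite: Valiant1979, Lemma 3.3] -/
theorem baseB_apply (c : List Bool → List Bool) (v : ℤ) (hv : v = -1 ∨ v = 0 ∨ v = 1 ∨ v = 2 ∨ v = 3) (hc : c vv = cls v) :
    baseB c vv = [decide (baseOf v = 1)] := by
  simp only [baseB, orB_apply, eqB_apply, hc, cst_apply, List.headD_cons, baseOf]
  rcases hv with rfl | rfl | rfl | rfl | rfl <;> simp <;> decide

end Values

/-! ### Value of `bitF` -/

/-- A one-bit answer equals `[decide P]` iff its truth is `P`. [folklore] -/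
theorem bit_congr {b : Bool} {P : Prop} [Decidable P] (h : b = true ↔ P) : [b] = [decide P] := by
  cases b
  · have : ¬P := fun hp => Bool.false_ne_true (h.2 hp)
    simp [this]
  · simp [h.1 rfl]

/-- **`bitF` computes the bit of Valiant's `0/1` matrix**: for `X, Y < n + n² (q+2)` (`n = 34m`,
`q = 15m`), `bitF ⟨⌜ψ⌝, ⟨1^X, 1^Y⟩⟩ = [b01 (mz ψ) n q X Y = 1]`. [cite: Valiant1979, Lemma 3.3] -/
theorem bitF_encode (hw : CNF.IsWidthEq 3 ψ) (X Y : ℕ)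
    (hX : X < 34 * ψ.length + 34 * ψ.length * (34 * ψ.length) * (15 * ψ.length + 2))
    (hY : Y < 34 * ψ.length + 34 * ψ.length * (34 * ψ.length) * (15 * ψ.length + 2)) :
    bitF (boolPair (encodingCNF.encode ψ) (boolPair (ones X) (ones Y))) =
      [decide (b01 (mz ψ) (34 * ψ.length) (15 * ψ.length) X Y = 1)] := by
  have hn := length_fstF_encode ψ
  have hm : 0 < ψ.length := by
    rcases Nat.eq_zero_or_pos ψ.length with h | h
    · rw [h] at hX; simp at hX
    · exact h
  -- ranges of the derived indices
  have hnn : 0 < 34 * ψ.length * (34 * ψ.length) := by positivity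
  have hpos : 0 < 34 * ψ.length * (34 * ψ.length) * (15 * ψ.length + 2) := by positivity
  have hsX : (X - 34 * ψ.length) / (15 * ψ.length + 2) < 34 * ψ.length * (34 * ψ.length) := by
    rw [Nat.div_lt_iff_lt_mul (by omega)]; omega
  have hsY : (Y - 34 * ψ.length) / (15 * ψ.length + 2) < 34 * ψ.length * (34 * ψ.length) := by
    rw [Nat.div_lt_iff_lt_mul (by omega)]; omega
  have huX : (X - 34 * ψ.length) / (15 * ψ.length + 2) / (34 * ψ.length) < 34 * ψ.length :=
    Nat.div_lt_of_lt_mul hsX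
  have huY : (Y - 34 * ψ.length) / (15 * ψ.length + 2) / (34 * ψ.length) < 34 * ψ.length :=
    Nat.div_lt_of_lt_mul hsY
  have hvX : (X - 34 * ψ.length) / (15 * ψ.length + 2) % (34 * ψ.length) < 34 * ψ.length := Nat.mod_lt _ (by omega)
  have hvY : (Y - 34 * ψ.length) / (15 * ψ.length + 2) % (34 * ψ.length) < 34 * ψ.length := Nat.mod_lt _ (by omega)
  have vUX : mzUX (boolPair (encodingCNF.encode ψ) (boolPair (ones X) (ones Y))) =
      cls (mz ψ ((X - 34 * ψ.length) / (15 * ψ.length + 2) / (34 * ψ.length))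
        ((X - 34 * ψ.length) / (15 * ψ.length + 2) % (34 * ψ.length))) := by
    rw [mzUX_arg, hn]; exact mzF_encode hw _ _ huX hvX
  have vUY : mzUY (boolPair (encodingCNF.encode ψ) (boolPair (ones X) (ones Y))) =
      cls (mz ψ ((Y - 34 * ψ.length) / (15 * ψ.length + 2) / (34 * ψ.length))
        ((Y - 34 * ψ.length) / (15 * ψ.length + 2) % (34 * ψ.length))) := by
    rw [mzUY_arg, hn]; exact mzF_encode hw _ _ huY hvY
  have aUX := actB_apply _ X Y mzUX _ (mz_mem ψ _ _) vUX
  have aUY := actB_apply _ X Y mzUY _ (mz_mem ψ _ _) vUY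
  rw [hn] at aUX aUY
  unfold b01
  by_cases hXn : X < 34 * ψ.length
  · by_cases hYn : Y < 34 * ψ.length
    · have vB := baseB_apply _ X Y mzF _ (mz_mem ψ X Y) (mzF_encode hw X Y hXn hYn)
      simp only [bitF, iteB_apply, ltB_apply, fR_val, fS_val, kN_val, hn, length_ones, hXn, hYn, decide_true,
        List.headD_cons, if_true, vB]
    · simp only [bitF, iteB_apply, ltB_apply, eqB_apply, andB_apply, fR_val, fS_val, kN_val, kUY_val, kZY_val, hn, aUY,
        cst_apply, length_ones, ones_inj, ones_eq_nil, hXn, hYn, decide_true, decide_false, List.headD_cons, if_true,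
        if_false, Bool.false_eq_true, List.length_nil]
      refine bit_congr ?_
      simp [Nat.pos_iff_ne_zero]
  · by_cases hYn : Y < 34 * ψ.length
    · simp only [bitF, iteB_apply, ltB_apply, eqB_apply, andB_apply, fR_val, fS_val, kN_val, kVX_val, kZX_val, hn, aUX,
        cst_apply, length_ones, ones_inj, hXn, hYn, decide_true, decide_false, List.headD_cons, if_true, if_false,
        Bool.false_eq_true]
      refine bit_congr ?_
      simp
    · simp only [bitF, iteB_apply, ltB_apply, eqB_apply, andB_apply, orB_apply, fR_val, fS_val, kN_val, kSX_val, kSY_val,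
        kZX_val, kZY_val, hn, aUX, cst_apply, length_ones, ones_inj, hXn, hYn, decide_false, List.headD_cons, if_false,
        Bool.false_eq_true]
      refine bit_congr ?_
      by_cases h1 : (X - 34 * ψ.length) / (15 * ψ.length + 2) = (Y - 34 * ψ.length) / (15 * ψ.length + 2)
      · by_cases h2 : (X - 34 * ψ.length) % (15 * ψ.length + 2) = (Y - 34 * ψ.length) % (15 * ψ.length + 2)
        · simp [h1, h2]
        · simp [h1, h2]
      · simp [h1]

end ValiantFP

end Literature.Computability.AlgebraicComplexity
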